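/-
Copyright: the b2b-balaban T⁴-continuum CRUX team, row NE7b leaf lineage `t4-ne7b-formalise-leaf-05` (gen 153). Project licence.
-/
import Literature.MathematicalPhysics.QuantumFieldTheory.Balaban1983to89.B9SectEKernel

/-!
# THE (h1) SLOT OF PRINT's `γ₀` ASSEMBLY, PROVED AS A SKELETON: the covariant curl form of the averaged field is dominated by the constrained
# fine energy, `F(QA) ≤ κ₁⟨A, KA⟩ + κ₂‖QA‖²`, with `κ₁ = (1−r)⁻¹(p(1+τc₀) + qc₀)`, `κ₂ = a(1−r)⁻¹(p(r+τc₀) + qc₀)` WRITTEN OUT from four displayed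
# letters — (N′) relative first-order smallness `r`, weighted positivity `c₀` of `G₀⁻¹`, the curl-by-energy bound `τ`, the covariant-Stokes letter `(p, q)` —
# and `κ₁ ≤ 40` at `p = 16`, `r ≤ ½`, `τc₀ ≤ ⅛`, `qc₀ ≤ 2`; plus the (hJ) slot from two letters (`θ_J = 2σc₅`); then `B9SectEKernel.gamma0_assembly` BY NAME with
# (h1), (hJ) SUPPLIED (row NE7b, node U5c; residual (R2′)
# family (2), letter (ℓ1) in B9 Sect. E's matrix currency; the twin of `…AdmissibleFloorIMS` ((h2)); kernel lemmas + junctions)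

Cell `pub-balaban`, sub-cell `t4`, spine estimate NE7b (`T4WeightBudget.RelWeightBound`; the cell's OWN estimate — NOT PRINTED in [Bałaban 1983–89],
NOT PROVED).  Crux-route work under `Spine/NE7b/`; NOTHING of Bałaban's is asserted; no `def`; zero `sorry`; no `T4Continuum/Support` leaf (FREEZE (0)).
Import (hub olean present): the reader cell's `….Balaban1983to89.B9SectEKernel` (r1; `gamma0_assembly`, `coercive_sandwich_of_range`, `form_add_gauss`,
`QGQInverse.Coercive`).

WHY.  `…CoerciveFluctuationFloor` §5 (leaf-05 g151) reads print's p. 428 «`C*Δ_kC` … lower bound `γ₀ > 0` independent of `k` and `U`» into the road's Hessian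
floor through `B9SectEKernel.gamma0_assembly` with (h1), (h2), (hJ) DISPLAYED (GAPS G-B9-09; written repair `HOME/b2b-balaban-r1/SectE-interface-proof.md`).
`…AdmissibleFloorIMS` (this lineage, gen 153) kernel-checks the (h2) proof's skeleton.  THIS FILE does the same for (h1): SectE-interface-proof §3 Lemma 3.3 ∕
(3.4) and §5.4 Prop. 5.4 — pure quadratic-form bookkeeping once the four analytic letters are displayed — so that after the pair, print's `γ₀′` is
`gamma0_assembly` applied to NAMED letters: (N′) `r`, `c₀`, `τ`, `(p, q) = (16, c₃ε_F²)` for (h1); `δ, u_s, ε_IMS` + PROVED flat Lemma 2.4 for (h2); `σ = c_H Mα₀`,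
`c₅` for (hJ) (§4b).

WHAT IS PROVED ([folklore]; fine index `n`, unit-lattice index `m`; matrices `K₀` (= `Δ + DRD*`), `T′` (the first-order Sect. D perturbation, `K = K₀ − T′`),
`S₀ = K₀ + aQᵀQ` (= `G₀⁻¹`); abstract nonnegative-type functionals `Nw` (‖·‖²_w), `NΩ` (‖·‖²_{L²(Ω_k)}), `Dsq` (‖D_U·‖²) on fine fields; `F` on unit-lattice fields):
* §1 (N′) BOOKKEEPING (Lemma 3.3; `⟨A,(K₀−T′)A⟩ = ⟨A,K₀A⟩ − ⟨A,T′A⟩` is the tree's `…QuadFormSimDiag.qf_sub`, inlined): `form_K_lower_of_rel` (`(1−r)⟨A,K₀A⟩ − ra‖QA‖² ≤ ⟨A,(K₀−T′)A⟩`), **`form_K0_le_of_rel`** (`⟨A,K₀A⟩ ≤ (1−r)⁻¹(⟨A,KA⟩ + ra‖QA‖²)`),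
  **`form_S0_le_of_rel`** (`⟨A,S₀A⟩ ≤ (1−r)⁻¹(⟨A,KA⟩ + a‖QA‖²)`), `form_S_lower_of_rel` (`(1−r)⟨A,S₀A⟩ ≤ ⟨A,(S₀−T′)A⟩` — positivity of `G₁⁻¹`),
  `coercive_sub_of_rel` (`S₀` coercive `γ` ⟹ `S₀ − T′` coercive `(1−r)γ`).
* §2 THE TWO DERIVED LETTERS: **`weighted_le_energy`** (`Nw A ≤ c₀(1−r)⁻¹(⟨A,KA⟩ + a‖QA‖²)` from `Nw A ≤ c₀⟨A,S₀A⟩`), **`curl_le_energy`** ((3.4):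
  `Dsq A ≤ (1−r)⁻¹[(1+τc₀)⟨A,KA⟩ + (r+τc₀)a‖QA‖²]` from `Dsq A ≤ ⟨A,K₀A⟩ + τ·Nw A`).
* §3 **`h1_of_letters`** (Prop. 5.4) — THE (h1) SLOT IN ITS BINDER SHAPE: from the covariant-Stokes letter `F(QA) ≤ p·Dsq A + q·NΩ A` and `NΩ ≤ Nw`:
  `∀ A, F(QA) ≤ κ₁⟨A,KA⟩ + κ₂‖QA‖²`, `κ₁ = (1−r)⁻¹(p(1+τc₀) + qc₀)`, `κ₂ = a(1−r)⁻¹(p(r+τc₀) + qc₀)` — VERBATIM the `h1` hypothesis of `gamma0_assembly`.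
* §4 THE CONSTANTS: **`kappa1_le_forty`** (`p = 16`, `r ≤ ½`, `0 ≤ τc₀ ≤ ⅛`, `0 ≤ qc₀ ≤ 2` ⊢ `κ₁ ≤ 40`), `kappa1_pos` (`0 < p`, `r < 1`, `τc₀, qc₀ ≥ 0` ⊢ `0 < κ₁`),
  `kappa2_le` (`κ₂ ≤ 2a(p(r+τc₀) + qc₀)` for `r ≤ ½` — the `O(Mα₀ + ε_F²)` shape).
* §4b **`hJ_of_letters`** (Lemma 5.7) — THE (hJ) SLOT: `⟨B, Jm B⟩ = 2Σ_x j(x)q_x(B)`, `|j| ≤ σ` (`= c_H Mα₀`), `Σ_x|q_x(B)| ≤ c₅‖B‖²` ⊢ `|⟨B, Jm B⟩| ≤ 2σc₅‖B‖²`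
  — VERBATIM the `hJ` hypothesis of `gamma0_assembly` (`θ = 2σc₅ = θ_J`).
* §5 **`gamma0_assembly_of_letters`** — `gamma0_assembly` BY NAME with (h1) := §3 ((h2), (hJ) displayed in their binder shapes):
  `((c − κ₂)∕κ₁ − θ)‖B‖² ≤ ⟨B,(P − a − 𝒥)B⟩` on `good` with `κ₁, κ₂` the §3 expressions; **`coercive_sandwich_of_letters`** (+ `coercive_sandwich_of_range`);
  **`gamma0_assembly_of_all_letters`** ((h1) := §3, (hJ) := §4b, (h2) in binder shape = `…AdmissibleFloorIMS.admissible_floor`'s conclusion).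
* §6 toy: `T′ = 0`, `r = τ = q = 0`, `p = 1`, `Dsq A = ⟨A,K₀A⟩`, `F(B) = ‖B‖²`-type bookkeeping closes (`example`).

NOT HERE (honest): the four letters BY VALUE — (N′) (G-B9-16 territory; SectE-interface-proof §8.2), Lemma 3.1's Schur input ((π1) Thm 3.3 (3.46) + B6
Lemma 2.1), Lemma 3.2 ((π3)), Lemma CS + reading (R-M) (§5.2–5.3, the note's one delicate identification); (h2) (`…AdmissibleFloorIMS.admissible_floor`
supplies its binder; not imported here — no hub olean yet), (hJ)'s two letters `σ, c₅` BY VALUE ((π6) (3.133)-decay of `H₁`, (π7) + reading R-D), the `(H, P)` invertibility letters (CFF §5 `hessian_lower_of_deltaK`); the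
`c∕640` combination (`…AdmissibleFloorIMS.gamma0_value_ge`, by name in a successor junction); WHICH matrices print's step displays ((A3) ∕ (A1c), NC-NE7b-α
UNRULED).  BY-NAME EFFECT ON THE WALL: NONE ((ℓ1)'s Sect. E supplier: (h1) ⇐ four displayed letters; the wall is (R2)).  NE7b NOT PRINTED ∕ NOT PROVED;
spine PROVED 0∕9; rung (B)+1 on ONE finite T⁴ — NOT infinite volume, NOT the mass gap, NOT Clay.
HONEST DEPENDENCY: continuum YM on T⁴ ⇐ BetaPertH ∧ nine spine estimates (0/9 proved); BetaPertH ⇐ (D1) ∧ (D4) ∧ CAP+tail; G-an2-4 gates asym, D1 and NE2/3/4.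
-/

set_option autoImplicit false

noncomputable section

open Matrix Finset
open Literature.MathematicalPhysics.QuantumFieldTheory.Balaban1983to89 (QGQInverse.Coercive)
open Literature.MathematicalPhysics.QuantumFieldTheory.Balaban1983to89.B9SectEKernel
  (form_add_gauss gamma0_assembly coercive_sandwich_of_range)

namespace Summit.QuantumFields.BalabanUV.T4Continuum.NE7b.CurlFormEnergyDomination

variable {n m : Type*} [Fintype n] [Fintype m]

/-! ## §1 (N′) bookkeeping (SectE-interface-proof Lemma 3.3): `K = K₀ − T′`, `S₀ = K₀ + aQᵀQ`, `⟨A,T′A⟩ ≤ r⟨A,S₀A⟩`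

The note's (N′) is two-sided, `|⟨A,T′A⟩| ≤ r⟨A,G₀⁻¹A⟩`; only its UPPER half `⟨A,T′A⟩ ≤ r⟨A,S₀A⟩` is consumed anywhere below (the floor side: (3.4),
(h1), `G₁⁻¹ ≥ (1−r)S₀`); the lower half is the CEILING's input (Theorem E2-type bounds), not (h1)'s — so `hrel` is stated one-sided. -/

section RelSmall

/-- **(N′) ⟹ a lower bound of the perturbed `K`**: `⟨A,T′A⟩ ≤ r⟨A,S₀A⟩`, `S₀ = K₀ + aQᵀQ` ⊢ `(1−r)⟨A,K₀A⟩ − r·a‖QA‖² ≤ ⟨A,(K₀−T′)A⟩`. [folklore] -/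
theorem form_K_lower_of_rel (K₀ T' : Matrix n n ℝ) (Q : Matrix m n ℝ) (a : ℝ) {r : ℝ}
    (hrel : ∀ A : n → ℝ, A ⬝ᵥ (T' *ᵥ A) ≤ r * (A ⬝ᵥ ((K₀ + a • (Qᵀ * Q)) *ᵥ A))) (A : n → ℝ) :
    (1 - r) * (A ⬝ᵥ (K₀ *ᵥ A)) - r * a * ((Q *ᵥ A) ⬝ᵥ (Q *ᵥ A)) ≤ A ⬝ᵥ ((K₀ - T') *ᵥ A) := by
  have h := hrel A
  rw [form_add_gauss] at h
  rw [Matrix.sub_mulVec, dotProduct_sub]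
  nlinarith

/-- **Lemma 3.3, first line**: for `r < 1`, `⟨A,K₀A⟩ ≤ (1−r)⁻¹(⟨A,KA⟩ + r·a‖QA‖²)`, `K = K₀ − T′`. [folklore] -/
theorem form_K0_le_of_rel (K₀ T' : Matrix n n ℝ) (Q : Matrix m n ℝ) (a : ℝ) {r : ℝ} (hr : r < 1)
    (hrel : ∀ A : n → ℝ, A ⬝ᵥ (T' *ᵥ A) ≤ r * (A ⬝ᵥ ((K₀ + a • (Qᵀ * Q)) *ᵥ A))) (A : n → ℝ) :
    A ⬝ᵥ (K₀ *ᵥ A) ≤ (1 - r)⁻¹ * (A ⬝ᵥ ((K₀ - T') *ᵥ A) + r * a * ((Q *ᵥ A) ⬝ᵥ (Q *ᵥ A))) := by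
  have h := form_K_lower_of_rel K₀ T' Q a hrel A
  have h1r : 0 < 1 - r := by linarith
  rw [← div_eq_inv_mul, le_div_iff₀ h1r]
  linarith

/-- **Lemma 3.3, the `S₀` line**: `⟨A,S₀A⟩ = ⟨A,K₀A⟩ + a‖QA‖² ≤ (1−r)⁻¹(⟨A,KA⟩ + a‖QA‖²)` (`ra∕(1−r) + a = a∕(1−r)`). [folklore] -/
theorem form_S0_le_of_rel (K₀ T' : Matrix n n ℝ) (Q : Matrix m n ℝ) (a : ℝ) {r : ℝ} (hr : r < 1)
    (hrel : ∀ A : n → ℝ, A ⬝ᵥ (T' *ᵥ A) ≤ r * (A ⬝ᵥ ((K₀ + a • (Qᵀ * Q)) *ᵥ A))) (A : n → ℝ) :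
    A ⬝ᵥ ((K₀ + a • (Qᵀ * Q)) *ᵥ A) ≤ (1 - r)⁻¹ * (A ⬝ᵥ ((K₀ - T') *ᵥ A) + a * ((Q *ᵥ A) ⬝ᵥ (Q *ᵥ A))) := by
  have h := form_K_lower_of_rel K₀ T' Q a hrel A
  have h1r : 0 < 1 - r := by linarith
  rw [form_add_gauss, ← div_eq_inv_mul, le_div_iff₀ h1r]
  nlinarith

/-- **Positivity of `G₁⁻¹ = S₀ − T′` that (3.155) presupposes**: `(1−r)⟨A,S₀A⟩ ≤ ⟨A,(S₀−T′)A⟩`. [folklore] -/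
theorem form_S_lower_of_rel (K₀ T' : Matrix n n ℝ) (Q : Matrix m n ℝ) (a : ℝ) {r : ℝ}
    (hrel : ∀ A : n → ℝ, A ⬝ᵥ (T' *ᵥ A) ≤ r * (A ⬝ᵥ ((K₀ + a • (Qᵀ * Q)) *ᵥ A))) (A : n → ℝ) :
    (1 - r) * (A ⬝ᵥ ((K₀ + a • (Qᵀ * Q)) *ᵥ A)) ≤ A ⬝ᵥ ((K₀ + a • (Qᵀ * Q) - T') *ᵥ A) := by
  have h := hrel A
  rw [Matrix.sub_mulVec, dotProduct_sub]
  linarith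

/-- … in coercivity currency: `S₀` coercive with `γ`, `r ≤ 1` ⊢ `S₀ − T′` coercive with `(1−r)γ`. [folklore] -/
theorem coercive_sub_of_rel (K₀ T' : Matrix n n ℝ) (Q : Matrix m n ℝ) (a : ℝ) {r γ : ℝ} (hr : r ≤ 1)
    (hS₀ : QGQInverse.Coercive (K₀ + a • (Qᵀ * Q)) γ)
    (hrel : ∀ A : n → ℝ, A ⬝ᵥ (T' *ᵥ A) ≤ r * (A ⬝ᵥ ((K₀ + a • (Qᵀ * Q)) *ᵥ A))) :
    QGQInverse.Coercive (K₀ + a • (Qᵀ * Q) - T') ((1 - r) * γ) := by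
  intro A
  have h := form_S_lower_of_rel K₀ T' Q a hrel A
  have h0 := hS₀ A
  have h1 : (1 - r) * (γ * (A ⬝ᵥ A)) ≤ (1 - r) * (A ⬝ᵥ ((K₀ + a • (Qᵀ * Q)) *ᵥ A)) :=
    mul_le_mul_of_nonneg_left h0 (by linarith)
  rw [mul_assoc]
  exact h1.trans h

end RelSmall

/-! ## §2 The two derived letters: weighted norm and curl by the constrained energy (Lemma 3.3 / (3.4)) -/

section Derived

/-- **Weighted norm by the energy**: `Nw A ≤ c₀⟨A,S₀A⟩` (Lemma 3.1, quantitative positivity of `G₀⁻¹`) and (N′) ⊢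
`Nw A ≤ c₀(1−r)⁻¹(⟨A,KA⟩ + a‖QA‖²)`. [folklore] -/
theorem weighted_le_energy (K₀ T' : Matrix n n ℝ) (Q : Matrix m n ℝ) (a : ℝ) {r c₀ : ℝ} (hr : r < 1) (hc₀ : 0 ≤ c₀)
    (hrel : ∀ A : n → ℝ, A ⬝ᵥ (T' *ᵥ A) ≤ r * (A ⬝ᵥ ((K₀ + a • (Qᵀ * Q)) *ᵥ A)))
    (Nw : (n → ℝ) → ℝ) (hNw : ∀ A : n → ℝ, Nw A ≤ c₀ * (A ⬝ᵥ ((K₀ + a • (Qᵀ * Q)) *ᵥ A))) (A : n → ℝ) :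
    Nw A ≤ c₀ * (1 - r)⁻¹ * (A ⬝ᵥ ((K₀ - T') *ᵥ A) + a * ((Q *ᵥ A) ⬝ᵥ (Q *ᵥ A))) := by
  have h := form_S0_le_of_rel K₀ T' Q a hr hrel A
  have h2 := mul_le_mul_of_nonneg_left h hc₀
  rw [mul_assoc]
  exact (hNw A).trans h2

/-- **(3.4) — CURL BY THE CONSTRAINED ENERGY**: `Dsq A ≤ ⟨A,K₀A⟩ + τ·Nw A` (Lemma 3.2: `‖D_UA‖² ≤ ⟨A,ΔA⟩ + τ‖A‖²_w ≤ ⟨A,K₀A⟩ + τ‖A‖²_w`,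
`τ = c₂Mα₀`), `Nw A ≤ c₀⟨A,S₀A⟩`, (N′) with `r < 1`, `τ ≥ 0`, `c₀ ≥ 0` ⊢ `Dsq A ≤ (1−r)⁻¹[(1+τc₀)⟨A,KA⟩ + (r+τc₀)a‖QA‖²]`. [folklore] -/
theorem curl_le_energy (K₀ T' : Matrix n n ℝ) (Q : Matrix m n ℝ) (a : ℝ) {r c₀ τ : ℝ} (hr : r < 1) (hc₀ : 0 ≤ c₀) (hτ : 0 ≤ τ)
    (hrel : ∀ A : n → ℝ, A ⬝ᵥ (T' *ᵥ A) ≤ r * (A ⬝ᵥ ((K₀ + a • (Qᵀ * Q)) *ᵥ A)))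
    (Nw Dsq : (n → ℝ) → ℝ) (hNw : ∀ A : n → ℝ, Nw A ≤ c₀ * (A ⬝ᵥ ((K₀ + a • (Qᵀ * Q)) *ᵥ A)))
    (hD : ∀ A : n → ℝ, Dsq A ≤ A ⬝ᵥ (K₀ *ᵥ A) + τ * Nw A) (A : n → ℝ) :
    Dsq A ≤ (1 - r)⁻¹ * ((1 + τ * c₀) * (A ⬝ᵥ ((K₀ - T') *ᵥ A)) + (r + τ * c₀) * a * ((Q *ᵥ A) ⬝ᵥ (Q *ᵥ A))) := by
  have hK0 := form_K0_le_of_rel K₀ T' Q a hr hrel A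
  have hW := weighted_le_energy K₀ T' Q a hr hc₀ hrel Nw hNw A
  have hW' := mul_le_mul_of_nonneg_left hW hτ
  have h := hD A
  have e : (1 - r)⁻¹ * ((1 + τ * c₀) * (A ⬝ᵥ ((K₀ - T') *ᵥ A)) + (r + τ * c₀) * a * ((Q *ᵥ A) ⬝ᵥ (Q *ᵥ A)))
      = (1 - r)⁻¹ * (A ⬝ᵥ ((K₀ - T') *ᵥ A) + r * a * ((Q *ᵥ A) ⬝ᵥ (Q *ᵥ A)))
        + τ * (c₀ * (1 - r)⁻¹ * (A ⬝ᵥ ((K₀ - T') *ᵥ A) + a * ((Q *ᵥ A) ⬝ᵥ (Q *ᵥ A)))) := by ring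
  rw [e]
  linarith

end Derived

/-! ## §3 (h1) in its binder shape (Prop. 5.4) -/

section H1

/-- **COVARIANT STOKES ∘ QUANTITATIVE POSITIVITY — THE (h1) SLOT OF `gamma0_assembly`, PROVED AS A SKELETON.**  Letters: (N′) `⟨A,T′A⟩ ≤ r⟨A,S₀A⟩`
(`r < 1`); weighted positivity `Nw A ≤ c₀⟨A,S₀A⟩` (`c₀ ≥ 0`); curl bound `Dsq A ≤ ⟨A,K₀A⟩ + τ·Nw A` (`τ ≥ 0`); the covariant-Stokes-plus-(R-M) letter
`F(QA) ≤ p·Dsq A + q·NΩ A` (`p, q ≥ 0`; print's use `p = 16`, `q = c₃ε_F²`) and `NΩ A ≤ Nw A` (`w ≥ 1` on `Ω_k`).  Conclusion, with `K = K₀ − T′`: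
`∀ A, F(QA) ≤ κ₁⟨A,KA⟩ + κ₂‖QA‖²`, `κ₁ = (1−r)⁻¹(p(1+τc₀) + qc₀)`, `κ₂ = a(1−r)⁻¹(p(r+τc₀) + qc₀)` — VERBATIM the `h1` hypothesis of
`B9SectEKernel.gamma0_assembly` (SectE-interface-proof Prop. 5.4). [folklore] -/
theorem h1_of_letters (K₀ T' : Matrix n n ℝ) (Q : Matrix m n ℝ) (a : ℝ) {r c₀ τ p q : ℝ}
    (hr : r < 1) (hc₀ : 0 ≤ c₀) (hτ : 0 ≤ τ) (hp : 0 ≤ p) (hq : 0 ≤ q)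
    (hrel : ∀ A : n → ℝ, A ⬝ᵥ (T' *ᵥ A) ≤ r * (A ⬝ᵥ ((K₀ + a • (Qᵀ * Q)) *ᵥ A)))
    (Nw NΩ Dsq : (n → ℝ) → ℝ) (hNw : ∀ A : n → ℝ, Nw A ≤ c₀ * (A ⬝ᵥ ((K₀ + a • (Qᵀ * Q)) *ᵥ A)))
    (hΩ : ∀ A : n → ℝ, NΩ A ≤ Nw A) (hD : ∀ A : n → ℝ, Dsq A ≤ A ⬝ᵥ (K₀ *ᵥ A) + τ * Nw A)
    (F : (m → ℝ) → ℝ) (hF : ∀ A : n → ℝ, F (Q *ᵥ A) ≤ p * Dsq A + q * NΩ A) :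
    ∀ A : n → ℝ, F (Q *ᵥ A) ≤ (1 - r)⁻¹ * (p * (1 + τ * c₀) + q * c₀) * (A ⬝ᵥ ((K₀ - T') *ᵥ A))
      + a * (1 - r)⁻¹ * (p * (r + τ * c₀) + q * c₀) * ((Q *ᵥ A) ⬝ᵥ (Q *ᵥ A)) := by
  intro A
  have hDA := mul_le_mul_of_nonneg_left (curl_le_energy K₀ T' Q a hr hc₀ hτ hrel Nw Dsq hNw hD A) hp
  have hWA := mul_le_mul_of_nonneg_left ((hΩ A).trans (weighted_le_energy K₀ T' Q a hr hc₀ hrel Nw hNw A)) hq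
  have h := hF A
  have e : (1 - r)⁻¹ * (p * (1 + τ * c₀) + q * c₀) * (A ⬝ᵥ ((K₀ - T') *ᵥ A))
      + a * (1 - r)⁻¹ * (p * (r + τ * c₀) + q * c₀) * ((Q *ᵥ A) ⬝ᵥ (Q *ᵥ A))
      = p * ((1 - r)⁻¹ * ((1 + τ * c₀) * (A ⬝ᵥ ((K₀ - T') *ᵥ A)) + (r + τ * c₀) * a * ((Q *ᵥ A) ⬝ᵥ (Q *ᵥ A))))
        + q * (c₀ * (1 - r)⁻¹ * (A ⬝ᵥ ((K₀ - T') *ᵥ A) + a * ((Q *ᵥ A) ⬝ᵥ (Q *ᵥ A)))) := by ring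
  rw [e]
  linarith

end H1

/-! ## §4 The constants (SectE-interface-proof §5.4: `κ₁ ≤ 40`, `κ₂ = O(Mα₀ + ε_F²)`) -/

section Constants

/-- **`κ₁ ≤ 40`**: at `p = 16`, `r ≤ ½`, `0 ≤ τc₀ ≤ ⅛`, `0 ≤ qc₀ ≤ 2`: `(1−r)⁻¹(16(1+τc₀) + qc₀) ≤ 2·(18 + 2) = 40`. [folklore] -/
theorem kappa1_le_forty {r c₀ τ q : ℝ} (hr : r ≤ 1 / 2) (hτc : 0 ≤ τ * c₀) (hτc' : τ * c₀ ≤ 1 / 8)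
    (hqc : 0 ≤ q * c₀) (hqc' : q * c₀ ≤ 2) :
    (1 - r)⁻¹ * (16 * (1 + τ * c₀) + q * c₀) ≤ 40 := by
  have h1r : 0 < 1 - r := by linarith
  have hinv : (1 - r)⁻¹ ≤ 2 := by
    rw [inv_le_comm₀ h1r (by norm_num : (0 : ℝ) < 2)]
    linarith
  have hb : 16 * (1 + τ * c₀) + q * c₀ ≤ 20 := by linarith
  have hb0 : 0 ≤ 16 * (1 + τ * c₀) + q * c₀ := by linarith
  calc (1 - r)⁻¹ * (16 * (1 + τ * c₀) + q * c₀) ≤ 2 * 20 :=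
        mul_le_mul hinv hb hb0 (by norm_num)
    _ = 40 := by norm_num

/-- `κ₁ > 0` (what `gamma0_assembly` needs): `0 < p`, `r < 1`, `τc₀ ≥ 0`, `qc₀ ≥ 0`. [folklore] -/
theorem kappa1_pos {r c₀ τ p q : ℝ} (hr : r < 1) (hp : 0 < p) (hτc : 0 ≤ τ * c₀) (hqc : 0 ≤ q * c₀) :
    0 < (1 - r)⁻¹ * (p * (1 + τ * c₀) + q * c₀) := by
  have h1r : 0 < (1 - r)⁻¹ := inv_pos.mpr (by linarith)
  have : 0 < p * (1 + τ * c₀) + q * c₀ := by nlinarith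
  positivity

/-- `κ₂ ≤ 2a(p(r+τc₀) + qc₀)` for `0 ≤ r ≤ ½`, `a ≥ 0`, nonnegative letters — the `O(Mα₀ + ε_F²) → 0` shape of Prop. 5.4. [folklore] -/
theorem kappa2_le {a r c₀ τ p q : ℝ} (ha : 0 ≤ a) (hr0 : 0 ≤ r) (hr : r ≤ 1 / 2) (hp : 0 ≤ p) (hτc : 0 ≤ τ * c₀)
    (hqc : 0 ≤ q * c₀) :
    a * (1 - r)⁻¹ * (p * (r + τ * c₀) + q * c₀) ≤ 2 * a * (p * (r + τ * c₀) + q * c₀) := by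
  have h1r : 0 < 1 - r := by linarith
  have hinv : (1 - r)⁻¹ ≤ 2 := by
    rw [inv_le_comm₀ h1r (by norm_num : (0 : ℝ) < 2)]
    linarith
  have hb0 : 0 ≤ p * (r + τ * c₀) + q * c₀ := by nlinarith
  have := mul_le_mul_of_nonneg_left hinv ha
  calc a * (1 - r)⁻¹ * (p * (r + τ * c₀) + q * c₀) ≤ a * 2 * (p * (r + τ * c₀) + q * c₀) :=
        mul_le_mul_of_nonneg_right this hb0
    _ = 2 * a * (p * (r + τ * c₀) + q * c₀) := by ring

end Constants

/-! ## §4b The (hJ) slot (SectE-interface-proof Lemma 5.7): `|⟨B, 𝒥B⟩| ≤ 2σ_J c₅‖B‖²` -/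

section HJ

/-- **THE J-TERM LETTER (hJ) FROM TWO DISPLAYED LETTERS** (Lemma 5.7: `|⟨B, 𝒥B⟩| = 2|⟨D̃^{(2)}(B), H₁*J⟩| ≤ 2 sup|H₁*J|·‖D̃^{(2)}(B)‖_{L¹} ≤
2c_H Mα₀·c₅‖B‖²`): the form of `Jm` is `2Σ_x j(x)·q_x(B)` with `j = H₁*J` bounded by `σ` ((π6): `σ = c_H Mα₀`) and the homogeneous quadratic map
`q = D̃^{(2)}` with `Σ_x |q_x(B)| ≤ c₅‖B‖²` ((π7), reading R-D) ⊢ `|⟨B, Jm B⟩| ≤ 2σc₅‖B‖²` — VERBATIM `gamma0_assembly`'s `hJ` with `θ := 2σc₅`.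
[folklore] (`ℓ¹–ℓ^∞` Hölder) -/
theorem hJ_of_letters {X : Type*} [Fintype X] (Jm : Matrix m m ℝ) (j : X → ℝ) (q : X → (m → ℝ) → ℝ) {σ c₅ : ℝ}
    (hσ : 0 ≤ σ) (hJm : ∀ B : m → ℝ, B ⬝ᵥ (Jm *ᵥ B) = 2 * ∑ x, j x * q x B)
    (hj : ∀ x, |j x| ≤ σ) (hq : ∀ B : m → ℝ, ∑ x, |q x B| ≤ c₅ * (B ⬝ᵥ B)) :
    ∀ B : m → ℝ, |B ⬝ᵥ (Jm *ᵥ B)| ≤ 2 * σ * c₅ * (B ⬝ᵥ B) := by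
  intro B
  rw [hJm B, abs_mul, abs_two]
  have h1 : |∑ x, j x * q x B| ≤ ∑ x, |j x * q x B| := Finset.abs_sum_le_sum_abs _ _
  have h2 : ∑ x, |j x * q x B| ≤ σ * ∑ x, |q x B| := by
    rw [Finset.mul_sum]
    refine Finset.sum_le_sum fun x _ => ?_
    rw [abs_mul]
    exact mul_le_mul_of_nonneg_right (hj x) (abs_nonneg _)
  have h3 := mul_le_mul_of_nonneg_left (hq B) hσ
  nlinarith

end HJ

/-! ## §5 `gamma0_assembly` BY NAME with (h1) supplied -/

section Assembly

variable [DecidableEq m]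

/-- **PRINT's `γ₀′` WITH (h1) SUPPLIED.**  `B9SectEKernel.gamma0_assembly`'s data VERBATIM with `K := K₀ − T′`, its `h1` replaced by §3's letters
(`r, c₀, τ, p, q`, `Nw, NΩ, Dsq` with their five inequalities, `0 < p`); (h2) and (hJ) in their binder shapes (the former is `…AdmissibleFloorIMS.
admissible_floor`'s conclusion).  Conclusion: `((c − κ₂)∕κ₁ − θ)‖B‖² ≤ ⟨B,(P − a − 𝒥)B⟩` on `good`, `κ₁, κ₂` the §3 expressions. [folklore] -/
theorem gamma0_assembly_of_letters (K₀ T' : Matrix n n ℝ) (Q : Matrix m n ℝ) (a : ℝ) (H : Matrix n m ℝ) (P Jm : Matrix m m ℝ)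
    (hQH : Q * H = 1) (hSH : (K₀ - T' + a • (Qᵀ * Q)) * H = Qᵀ * P) (good : (m → ℝ) → Prop)
    (F : (m → ℝ) → ℝ) {r c₀ τ p q c θ : ℝ}
    (hr : r < 1) (hc₀ : 0 ≤ c₀) (hτ : 0 ≤ τ) (hp : 0 < p) (hq : 0 ≤ q)
    (hrel : ∀ A : n → ℝ, A ⬝ᵥ (T' *ᵥ A) ≤ r * (A ⬝ᵥ ((K₀ + a • (Qᵀ * Q)) *ᵥ A)))
    (Nw NΩ Dsq : (n → ℝ) → ℝ) (hNw : ∀ A : n → ℝ, Nw A ≤ c₀ * (A ⬝ᵥ ((K₀ + a • (Qᵀ * Q)) *ᵥ A)))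
    (hΩ : ∀ A : n → ℝ, NΩ A ≤ Nw A) (hD : ∀ A : n → ℝ, Dsq A ≤ A ⬝ᵥ (K₀ *ᵥ A) + τ * Nw A)
    (hF : ∀ A : n → ℝ, F (Q *ᵥ A) ≤ p * Dsq A + q * NΩ A)
    (h2 : ∀ B : m → ℝ, good B → c * (B ⬝ᵥ B) ≤ F B)
    (hJ : ∀ B : m → ℝ, |B ⬝ᵥ (Jm *ᵥ B)| ≤ θ * (B ⬝ᵥ B)) (B : m → ℝ) (hB : good B) :
    ((c - a * (1 - r)⁻¹ * (p * (r + τ * c₀) + q * c₀)) / ((1 - r)⁻¹ * (p * (1 + τ * c₀) + q * c₀)) - θ) * (B ⬝ᵥ B)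
      ≤ B ⬝ᵥ ((P - a • (1 : Matrix m m ℝ) - Jm) *ᵥ B) :=
  gamma0_assembly (K₀ - T') Q a H P Jm hQH hSH good F (kappa1_pos hr hp (mul_nonneg hτ hc₀) (mul_nonneg hq hc₀))
    (h1_of_letters K₀ T' Q a hr hc₀ hτ hp.le hq hrel Nw NΩ Dsq hNw hΩ hD F hF) h2 hJ B hB

/-- **… AND THE SANDWICH (3.157)–(3.158)** (`coercive_sandwich_of_range` BY NAME): with `C` into the admissible subspace, norm-non-decreasing, and the
floor nonnegative ⊢ `QGQInverse.Coercive (Cᵀ(P − a − 𝒥)C) ((c − κ₂)∕κ₁ − θ)`. [folklore] -/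
theorem coercive_sandwich_of_letters {s : Type*} [Fintype s]
    (K₀ T' : Matrix n n ℝ) (Q : Matrix m n ℝ) (a : ℝ) (H : Matrix n m ℝ) (P Jm : Matrix m m ℝ)
    (hQH : Q * H = 1) (hSH : (K₀ - T' + a • (Qᵀ * Q)) * H = Qᵀ * P) (good : (m → ℝ) → Prop)
    (F : (m → ℝ) → ℝ) {r c₀ τ p q c θ : ℝ}
    (hr : r < 1) (hc₀ : 0 ≤ c₀) (hτ : 0 ≤ τ) (hp : 0 < p) (hq : 0 ≤ q)
    (hrel : ∀ A : n → ℝ, A ⬝ᵥ (T' *ᵥ A) ≤ r * (A ⬝ᵥ ((K₀ + a • (Qᵀ * Q)) *ᵥ A)))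
    (Nw NΩ Dsq : (n → ℝ) → ℝ) (hNw : ∀ A : n → ℝ, Nw A ≤ c₀ * (A ⬝ᵥ ((K₀ + a • (Qᵀ * Q)) *ᵥ A)))
    (hΩ : ∀ A : n → ℝ, NΩ A ≤ Nw A) (hD : ∀ A : n → ℝ, Dsq A ≤ A ⬝ᵥ (K₀ *ᵥ A) + τ * Nw A)
    (hF : ∀ A : n → ℝ, F (Q *ᵥ A) ≤ p * Dsq A + q * NΩ A)
    (h2 : ∀ B : m → ℝ, good B → c * (B ⬝ᵥ B) ≤ F B)
    (hJ : ∀ B : m → ℝ, |B ⬝ᵥ (Jm *ᵥ B)| ≤ θ * (B ⬝ᵥ B))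
    (C : Matrix m s ℝ) (hgood : ∀ v : s → ℝ, good (C *ᵥ v)) (hC : ∀ v : s → ℝ, v ⬝ᵥ v ≤ (C *ᵥ v) ⬝ᵥ (C *ᵥ v))
    (hγ : 0 ≤ (c - a * (1 - r)⁻¹ * (p * (r + τ * c₀) + q * c₀)) / ((1 - r)⁻¹ * (p * (1 + τ * c₀) + q * c₀)) - θ) :
    QGQInverse.Coercive (Cᵀ * (P - a • (1 : Matrix m m ℝ) - Jm) * C)
      ((c - a * (1 - r)⁻¹ * (p * (r + τ * c₀) + q * c₀)) / ((1 - r)⁻¹ * (p * (1 + τ * c₀) + q * c₀)) - θ) :=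
  coercive_sandwich_of_range (P - a • (1 : Matrix m m ℝ) - Jm) C good hγ hgood hC
    (gamma0_assembly_of_letters K₀ T' Q a H P Jm hQH hSH good F hr hc₀ hτ hp hq hrel Nw NΩ Dsq hNw hΩ hD hF h2 hJ)

/-- **ALL THREE INPUTS BY LETTERS BUT (h2)**: `gamma0_assembly` BY NAME with `h1` := §3 and `hJ` := §4b (`θ = 2σc₅`); (h2) in its binder shape (the
conclusion of `…AdmissibleFloorIMS.admissible_floor`, `c = c_flat∕2 − δ − ε∕2`).  Conclusion: `((c − κ₂)∕κ₁ − 2σc₅)‖B‖² ≤ ⟨B,(P − a − 𝒥)B⟩` on `good` —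
print's p. 428 `γ₀′` as ONE theorem of the named letters `r, c₀, τ, (p,q), σ, c₅` and the (h2) floor. [folklore] -/
theorem gamma0_assembly_of_all_letters {X : Type*} [Fintype X]
    (K₀ T' : Matrix n n ℝ) (Q : Matrix m n ℝ) (a : ℝ) (H : Matrix n m ℝ) (P Jm : Matrix m m ℝ)
    (hQH : Q * H = 1) (hSH : (K₀ - T' + a • (Qᵀ * Q)) * H = Qᵀ * P) (good : (m → ℝ) → Prop)
    (F : (m → ℝ) → ℝ) {r c₀ τ p q c σ c₅ : ℝ}
    (hr : r < 1) (hc₀ : 0 ≤ c₀) (hτ : 0 ≤ τ) (hp : 0 < p) (hq : 0 ≤ q) (hσ : 0 ≤ σ)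
    (hrel : ∀ A : n → ℝ, A ⬝ᵥ (T' *ᵥ A) ≤ r * (A ⬝ᵥ ((K₀ + a • (Qᵀ * Q)) *ᵥ A)))
    (Nw NΩ Dsq : (n → ℝ) → ℝ) (hNw : ∀ A : n → ℝ, Nw A ≤ c₀ * (A ⬝ᵥ ((K₀ + a • (Qᵀ * Q)) *ᵥ A)))
    (hΩ : ∀ A : n → ℝ, NΩ A ≤ Nw A) (hD : ∀ A : n → ℝ, Dsq A ≤ A ⬝ᵥ (K₀ *ᵥ A) + τ * Nw A)
    (hF : ∀ A : n → ℝ, F (Q *ᵥ A) ≤ p * Dsq A + q * NΩ A)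
    (h2 : ∀ B : m → ℝ, good B → c * (B ⬝ᵥ B) ≤ F B)
    (j : X → ℝ) (qd : X → (m → ℝ) → ℝ) (hJm : ∀ B : m → ℝ, B ⬝ᵥ (Jm *ᵥ B) = 2 * ∑ x, j x * qd x B)
    (hj : ∀ x, |j x| ≤ σ) (hqd : ∀ B : m → ℝ, ∑ x, |qd x B| ≤ c₅ * (B ⬝ᵥ B)) (B : m → ℝ) (hB : good B) :
    ((c - a * (1 - r)⁻¹ * (p * (r + τ * c₀) + q * c₀)) / ((1 - r)⁻¹ * (p * (1 + τ * c₀) + q * c₀)) - 2 * σ * c₅)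
        * (B ⬝ᵥ B) ≤ B ⬝ᵥ ((P - a • (1 : Matrix m m ℝ) - Jm) *ᵥ B) :=
  gamma0_assembly_of_letters K₀ T' Q a H P Jm hQH hSH good F hr hc₀ hτ hp hq hrel Nw NΩ Dsq hNw hΩ hD hF h2
    (hJ_of_letters Jm j qd hσ hJm hj hqd) B hB

end Assembly

/-! ## §6 Toy: no perturbation, the curl form IS the `K₀`-energy — the bookkeeping closes with `κ₁ = p`, `κ₂ = 0` -/

section Toy

/- `T′ = 0`, `r = τ = q = 0`, `c₀ = 0`, `p = 1`, `Nw = NΩ = 0`, `Dsq A = ⟨A,K₀A⟩`, `F(QA) := ⟨A,K₀A⟩` read through `hF`: §3 returns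
`F(QA) ≤ (1−0)⁻¹(1·(1+0)+0)⟨A,(K₀−0)A⟩ + a(1−0)⁻¹(1·(0+0)+0)‖QA‖²`. -/
example (K₀ : Matrix (Fin 2) (Fin 2) ℝ) (Q : Matrix (Fin 1) (Fin 2) ℝ) (a : ℝ) (F : (Fin 1 → ℝ) → ℝ)
    (hF : ∀ A : Fin 2 → ℝ, F (Q *ᵥ A) ≤ 1 * (A ⬝ᵥ (K₀ *ᵥ A)) + 0 * (0 : ℝ)) (A : Fin 2 → ℝ) :
    F (Q *ᵥ A) ≤ (1 - 0)⁻¹ * (1 * (1 + 0 * 0) + 0 * 0) * (A ⬝ᵥ ((K₀ - 0) *ᵥ A))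
      + a * (1 - 0)⁻¹ * (1 * (0 + 0 * 0) + 0 * 0) * ((Q *ᵥ A) ⬝ᵥ (Q *ᵥ A)) :=
  h1_of_letters K₀ 0 Q a (r := 0) (c₀ := 0) (τ := 0) (p := 1) (q := 0) (by norm_num) le_rfl le_rfl zero_le_one le_rfl
    (fun A => by rw [Matrix.zero_mulVec, dotProduct_zero, zero_mul])
    (fun _ => 0) (fun _ => 0) (fun A => A ⬝ᵥ (K₀ *ᵥ A)) (fun A => by rw [zero_mul])
    (fun _ => le_rfl) (fun A => by rw [mul_zero, add_zero]) F hF A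

end Toy

end Summit.QuantumFields.BalabanUV.T4Continuum.NE7b.CurlFormEnergyDomination

end
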